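import Summits.MatrixMultiplication.OmegaCensus.ThreeSetZ5LineTable34
import Summits.MatrixMultiplication.OmegaCensus.ThreeSetZ5Z5Data34
import Summits.MatrixMultiplication.OmegaCensus.ThreeSetZ5Z13MomentCertificate
import Summits.MatrixMultiplication.OmegaCensus.ThreeSetZ5Z5CoverKitE
import HarnessLib

/-!
# The `ℤ₅ × ℤ₅` stage for parts `3` and `4` at `|A| = 325`: cover with exceptions, plane certificates, moment certificates

ω-census `pub-omega`, family (b3), seat pub-omega-group gen 37.  Framing: lottery ticket; floor = certified bounds/negative
ranges.  VALUE: the finite kernel computation behind `ThreeSetZ5Z65Cells3x.lean` (no cube symmetric form with `|W| = 3`, `|X| = 4` over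
`A ↠ ℤ₅ × ℤ₅` of order `325` with a compatible projection onto `ℤ₁₃` — census cell `(3,4,9)@325` of `ℤ₅ × ℤ₆₅`); NOT progress on ω.

With `W` normalised to `T = {0, e₁, e₂}` in `ℤ₅²`, the image multiset of `X` is a count vector `g` (`Σ g = 4`) and the hole `x₀` sits at
a point index `σ < 25`.  **`fin34`**: EITHER some direction `j ≤ 5` carries a modular three-set line certificate at the hole value of
that direction (for all but 34 vectors `g` a HOLE-INDEPENDENT one: tree `tree34`, predicate `certHI34`, kernel programs `soundChk3` /
`cover3E` of `ThreeSetZ5Z5CoverKit(E)`), OR `g` is one of the 34 listed exceptions `excFlat34` and then, per hole: a per-hole line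
certificate (624 pairs), a plane ROW certificate refuting the `ℤ₅²` identity at fibre size `13` (`refuteRowOK`, 224 pairs), or — only at the
centroid hole `σ = 12`, for 2 vectors — a PINNING certificate fixing the fibre counts of `Y` (`pinRowsOK`) together with the two `𝔽₁₃`
test-vector certificates (`momentCertOK`) of the moment stage.  All data are untrusted and re-checked by `decide` (Python twin:
`pub-omega-group-g37/code/gen.py`, `moment.py`).
-/

namespace Summit.MatrixMultiplication.OmegaCensus

namespace Z5Z5ThreeSet

open Finset ZpZpDomino

/-! ## Line tables: dispatch by direction, annihilation checks, predicates -/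

/-- The certified line table of direction `j ≤ 5` for `|X| = 4`. [folklore] -/
def T34 (j : ℕ) : List (List ℕ × List (ℕ × List ℕ)) :=
  if j ≤ 1 then table34_21000 else if j = 2 then table34_12000 else if j = 3 then table34_11100
  else if j = 4 then table34_11010 else table34_11001

/-- Table check (line image `21000`). [folklore] -/
theorem ann34_21000 : (table34_21000.all fun e => annOKNat [2, 1, 0, 0, 0] e.1 e.2) = true := by decide +kernel

/-- Table check (line image `12000`). [folklore] -/
theorem ann34_12000 : (table34_12000.all fun e => annOKNat [1, 2, 0, 0, 0] e.1 e.2) = true := by decide +kernel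

/-- Table check (line image `11100`). [folklore] -/
theorem ann34_11100 : (table34_11100.all fun e => annOKNat [1, 1, 1, 0, 0] e.1 e.2) = true := by decide +kernel

/-- Table check (line image `11010`). [folklore] -/
theorem ann34_11010 : (table34_11010.all fun e => annOKNat [1, 1, 0, 1, 0] e.1 e.2) = true := by decide +kernel

/-- Table check (line image `11001`). [folklore] -/
theorem ann34_11001 : (table34_11001.all fun e => annOKNat [1, 1, 0, 0, 1] e.1 e.2) = true := by decide +kernel

/-- All table checks, indexed by the direction. [folklore] -/
theorem ann34 (j : ℕ) (hj : j < 6) : ((T34 j).all fun e => annOKNat (wvec j) e.1 e.2) = true := by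
  have h6 : j = 0 ∨ j = 1 ∨ j = 2 ∨ j = 3 ∨ j = 4 ∨ j = 5 := by omega
  rcases h6 with rfl | rfl | rfl | rfl | rfl | rfl
  · exact ann34_21000
  · exact ann34_21000
  · exact ann34_12000
  · exact ann34_11100
  · exact ann34_11010
  · exact ann34_11001

/-- **Hole-independent certified-direction predicate**: an entry with key `F` whose certificates exclude every hole value. [folklore] -/
def certHI34 (j : ℕ) (F : List ℕ) : Bool :=
  (T34 j).any fun e => e.1 == F && (List.range 5).all fun v => exclOK e.2 v

/-- **Per-hole certified-direction predicate** at the hole value `pv 5 j σ`. [folklore] -/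
def certAt34 (σ j : ℕ) (F : List ℕ) : Bool :=
  (T34 j).any fun e => e.1 == F && exclOK e.2 (pv 5 j σ)

/-- From `certHI34` to a passing `lineCert3At` at every hole value. [folklore] -/
theorem lineCert3At_of_certHI34 {j : ℕ} {F : List ℕ} (hj : j < 6) (h : certHI34 j F = true) (v : ℕ) (hv : v < 5) :
    ∃ certs : List (ℕ × List ℕ), lineCert3At 5 (vecFn (wvec j)) (vecFn F) certs ((v : ℕ) : ZMod 5) = true := by
  simp only [certHI34, List.any_eq_true, Bool.and_eq_true, beq_iff_eq, List.all_eq_true, List.mem_range] at h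
  obtain ⟨e, he, h1, h2⟩ := h
  have ha := ann34 j hj
  rw [List.all_eq_true] at ha
  have h3 := ha e he
  rw [h1] at h3
  exact ⟨e.2, lineCert3At_of_nat hv h3 (h2 v hv)⟩

/-- From `certAt34` to a passing `lineCert3At` at the hole value of direction `j`. [folklore] -/
theorem lineCert3At_of_certAt34 {σ j : ℕ} {F : List ℕ} (hj : j < 6) (h : certAt34 σ j F = true) :
    ∃ certs : List (ℕ × List ℕ), lineCert3At 5 (vecFn (wvec j)) (vecFn F) certs ((pv 5 j σ : ℕ) : ZMod 5) = true := by
  simp only [certAt34, List.any_eq_true, Bool.and_eq_true, beq_iff_eq] at h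
  obtain ⟨e, he, h1, h2⟩ := h
  have ha := ann34 j hj
  rw [List.all_eq_true] at ha
  have h3 := ha e he
  rw [h1] at h3
  exact ⟨e.2, lineCert3At_of_nat (pv_lt 5 j σ) h3 h2⟩

/-! ## The cover with exceptions -/

/-- The flat lists agree with the row matrices. [folklore] -/
theorem excFlat34_spec : ∀ k < 34, ∀ i < 25,
    ((excFlat34.getD k []).getD i 0) = ((exc34.getD k []).getD (i / 5) []).getD (i % 5) 0 := by decide +kernel

/-- **Soundness check**: every unflagged (direction, count vector) is hole-independently certified. [folklore] -/
theorem sound34 : soundChk3 5 4 tree34 certHI34 = true := by decide +kernel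

/-- **Cover computation with exceptions**: every count vector of size `4` on `ℤ₅²` has an unflagged direction or is listed. [folklore] -/
theorem cover34 : cover3E 5 4 tree34 exc34 = true := by decide +kernel

/-- **Bridge checks** for the exceptional vectors (`planeMat = pmNat`). [folklore] -/
theorem bridge34 : ∀ k < 34, bridgeOK (excFlat34.getD k []) = true := by decide +kernel

/-! ## Per-hole dispatch of the exceptions -/

/-- The count vector of direction `j` of a flat list (the list form of `ZpZpDomino.cnts`). [folklore] -/
def cntsL34 (j : ℕ) (flat : List ℕ) : List ℕ :=
  List.ofFn fun v : Fin 5 => ∑ i : Fin (5 * 5), pick v.val (pv 5 j i.val) (flat.getD i.val 0)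

/-- `cnts 5 j g` of a function listed by `flat` is `cntsL34 j flat`. [folklore] -/
theorem cnts_eq_cntsL34 {g : Fin (5 * 5) → ℕ} {flat : List ℕ} (hg : ∀ i : Fin (5 * 5), g i = flat.getD i.val 0) (j : ℕ) :
    cnts 5 j g = cntsL34 j flat := by
  unfold cnts cntsL34
  exact congrArg List.ofFn (funext fun v => Fintype.sum_congr _ _ fun i => by rw [hg i])

/-- **Dispatch program for every (exception, hole) pair** (`Bool`; one kernel computation): a per-hole line certificate,
a plane row refutation, or (hole `12`) a pinning certificate with its two moment certificates. [folklore] -/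
def dispChk34 : Bool :=
  (List.range 34).all fun k => (List.range 25).all fun σ =>
    ((displine34.any fun c => c.1 == k && c.2.1 == σ && decide (c.2.2 < 6) &&
        certAt34 σ c.2.2 (cntsL34 c.2.2 (excFlat34.getD k []))) ||
      (refute34.any fun c => c.1 == k && c.2.1 == σ && decide (c.2.2.1 < 25) &&
        refuteRowOK (excFlat34.getD k []) σ (c.2.2.1, c.2.2.2.1, zrow c.2.2.2.2.1 c.2.2.2.2.2))) ||
    (σ == 12 && pins34.any fun p => p.1 == k && pinRowsOK (excFlat34.getD k []) 12 p.2.1 (zrows p.2.2.1) &&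
      momentCertOK (excFlat34.getD k []) p.2.1 p.2.2.2.1 1 0 && momentCertOK (excFlat34.getD k []) p.2.1 p.2.2.2.2 0 1)

/-- **The dispatch program passes.** [folklore] -/
theorem dispChk34_eq : dispChk34 = true := by decide +kernel

/-! ## The assembled finite statement -/

/-- **The `ℤ₅²` stage for parts `3, 4` at fibre size `13`.**  For every count vector `g` of size `4` on `ℤ₅²` and every hole index
`σ < 25`: a certified line direction at the hole value, or `g` is an explicit list `e` (with `planeMat e = pmNat e` checked) carrying a
plane row refutation at `σ`, or (`σ = 12`) a pinning certificate for the fibre counts of `Y` plus the two moment certificates. [folklore] -/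
theorem fin34 (g : Fin (5 * 5) → ℕ) (hg : ∑ i, g i = 4) (σ : ℕ) (hσ : σ < 25) :
    (∃ j < 6, ∃ certs : List (ℕ × List ℕ),
      lineCert3At 5 (vecFn (wvec j)) (vecFn (cnts 5 j g)) certs ((pv 5 j σ : ℕ) : ZMod 5) = true) ∨
    ∃ e : List ℕ, (∀ i : Fin (5 * 5), g i = e.getD i.val 0) ∧ bridgeOK e = true ∧
      ((∃ c : ℕ × ℕ × List ℤ, c.1 < 25 ∧ refuteRowOK e σ c = true) ∨
       (σ = 12 ∧ ∃ h : List ℕ, ∃ rows : List (ℕ × List ℤ), ∃ L₁ L₂ : List ℕ,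
          pinRowsOK e 12 h rows = true ∧ momentCertOK e h L₁ 1 0 = true ∧ momentCertOK e h L₂ 0 1 = true)) := by
  rcases exists_cert_or_exc_of_cover3E tree34 exc34 certHI34 sound34 cover34 g hg with ⟨j, hj, hc⟩ | hmem
  · have hj6 : j < 6 := by omega
    obtain ⟨certs, h⟩ := lineCert3At_of_certHI34 hj6 hc (pv 5 j σ) (pv_lt 5 j σ)
    exact Or.inl ⟨j, hj6, certs, h⟩
  · obtain ⟨k, hk, hrow⟩ := List.getElem_of_mem hmem
    have hK : k < 34 := by simpa [exc34] using hk
    have hgetD : exc34.getD k [] = exc34[k] := List.getD_eq_getElem _ _ hk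
    have hg' : ∀ i : Fin (5 * 5), g i = (excFlat34.getD k []).getD i.val 0 := by
      intro i
      have ht : i.val / 5 < 5 := by omega
      have hu : i.val % 5 < 5 := Nat.mod_lt _ (by omega)
      have hcell : cell (⟨i.val / 5, ht⟩ : Fin 5) ⟨i.val % 5, hu⟩ = i := Fin.ext (by rw [cell_val]; exact Nat.div_add_mod' i.val 5)
      have h1 := apply_cell_of_rowsOf_eq hrow.symm ⟨i.val / 5, ht⟩ ⟨i.val % 5, hu⟩
      rw [hcell] at h1
      rw [h1, excFlat34_spec k hK i.val i.isLt, hgetD]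
      rfl
    have hd := dispChk34_eq
    rw [dispChk34, List.all_eq_true] at hd
    have hd1 := hd k (List.mem_range.2 hK)
    rw [List.all_eq_true] at hd1
    have hd2 := hd1 σ (List.mem_range.2 hσ)
    simp only [Bool.or_eq_true, List.any_eq_true, Bool.and_eq_true, beq_iff_eq, decide_eq_true_eq] at hd2
    rcases hd2 with (⟨c, -, ⟨⟨-, -⟩, hj6⟩, hcert⟩ | ⟨c, -, ⟨⟨-, -⟩, hu⟩, hcert⟩) | ⟨h12, p, -, ⟨⟨-, hpin⟩, hm1⟩, hm2⟩
    · left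
      obtain ⟨certs, hc⟩ := lineCert3At_of_certAt34 hj6 hcert
      refine ⟨c.2.2, hj6, certs, ?_⟩
      rw [cnts_eq_cntsL34 hg' c.2.2]
      exact hc
    · right
      exact ⟨excFlat34.getD k [], hg', bridge34 k hK, Or.inl ⟨(c.2.2.1, c.2.2.2.1, zrow c.2.2.2.2.1 c.2.2.2.2.2), hu, hcert⟩⟩
    · right
      exact ⟨excFlat34.getD k [], hg', bridge34 k hK,
        Or.inr ⟨h12, p.2.1, zrows p.2.2.1, p.2.2.2.1, p.2.2.2.2, hpin, hm1, hm2⟩⟩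

end Z5Z5ThreeSet

end Summit.MatrixMultiplication.OmegaCensus
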